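import Summits.Ventures.Crystal3D.Bulk.GapCensusSkeleton
import HarnessLib

/-!
# Reduced extremal configurations for the GAP census (TARGET-GAP §4.2, second half) and the
# "no shift" principle P-L1 as a one-line corollary

HONEST FRAMING. Part of the venture `Summits/Ventures/Crystal3D` (cell `pub-crystal3d`, phase 2,
24-hour sprint `PLAN.md` R42; seat typer-bulk-2). `Bulk/GapCensusSkeleton.lean` proves that if
GAP(h) fails then a MOST-INTRUDING admissible fourteen-ball configuration exists
(`exists_isMinOn_intruder`). The census method of Musin–Tarasov (cell files `TARGET-GAP.md` §4.2,
`DESIGN-L12-THEORY.md` §T0/P-L1) works with a REDUCED extremal pair: among the extremal ones, one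
with the FEWEST TIGHT PAIRS (shell–shell contacts and intruder–shell contacts). This file defines
`tightCount`, `IsExtremal`, `IsReducedExtremal`, proves their existence whenever GAP(h) fails
(`exists_isReducedExtremal`, `not_gapTupleDiam_iff_exists_isReducedExtremal` — well-ordering of `ℕ`
on top of compactness), and records P-L1 in its relocation form as an immediate consequence
(`IsReducedExtremal.tightCount_le`: an admissible modification that does not push the intruder
out has at least as many tight pairs — so a "shift" strictly decreasing the tight pairs is
impossible). The census completeness hypothesis may therefore be stated for reduced extremal
configurations only (`GapCensus.CompleteReduced`, `gapTupleDiam_of_completeReduced`). The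
geometric consequences of P-L1 (vertex degrees, face structure: P-L2, P-L3, Lemma L) are NOT
proved here; they remain the theory seats' named obligations inside `CompleteReduced`.
-/

noncomputable section

open scoped BigOperators
open Finset

namespace Summit.Ventures.Crystal3D

/-! ## Tight pairs, extremal and reduced extremal configurations -/

/-- The **number of tight pairs** of a fourteen-ball configuration: unordered pairs among the
balls `1, …, 13` (the twelve shell balls and the intruder; NOT the centre `0`, whose twelve
contacts are prescribed) at distance exactly `1` — shell–shell contacts (`x–x` at `60°`) and
intruder–shell contacts (`p–x` at exactly `ρ`). -/
def tightCount (c : Fin 14 → EuclideanSpace ℝ (Fin 3)) : ℕ :=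
  ((univ ×ˢ univ).filter fun q : Fin 14 × Fin 14 =>
    q.1 ≠ 0 ∧ q.1 < q.2 ∧ dist (c q.1) (c q.2) = 1).card

/-- An **extremal** configuration: admissible and minimising the intruder distance among all
admissible configurations (the "extremal pair `ρ(X,p) = ρ*`"). -/
def IsExtremal (c : Fin 14 → EuclideanSpace ℝ (Fin 3)) : Prop :=
  IsGapConfig c ∧ ∀ c', IsGapConfig c' → intruderDist c ≤ intruderDist c'

/-- A **reduced extremal** configuration: extremal with the fewest tight pairs among all
extremal configurations. -/
def IsReducedExtremal (c : Fin 14 → EuclideanSpace ℝ (Fin 3)) : Prop :=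
  IsExtremal c ∧ ∀ c', IsExtremal c' → tightCount c ≤ tightCount c'

/-- Extremal configurations all have the same intruder distance. -/
theorem IsExtremal.intruderDist_eq {c c' : Fin 14 → EuclideanSpace ℝ (Fin 3)} (hc : IsExtremal c)
    (hc' : IsExtremal c') : intruderDist c = intruderDist c' :=
  le_antisymm (hc.2 c' hc'.1) (hc'.2 c hc.1)

/-- An admissible configuration intruding no further out than an extremal one is extremal. -/
theorem IsExtremal.of_le {c c' : Fin 14 → EuclideanSpace ℝ (Fin 3)} (hc : IsExtremal c)
    (hc' : IsGapConfig c') (hle : intruderDist c' ≤ intruderDist c) : IsExtremal c' :=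
  ⟨hc', fun c'' hc'' => hle.trans (hc.2 c'' hc'')⟩

/-- **Reduced extremal configurations exist** as soon as some admissible configuration intrudes
within `h` (compactness, `exists_isMinOn_intruder`, then well-ordering of the tight counts). -/
theorem exists_isReducedExtremal {h : ℝ} (hne : ∃ c, IsGapConfig c ∧ intruderDist c ≤ h) :
    ∃ c, IsReducedExtremal c ∧ intruderDist c ≤ h := by
  classical
  obtain ⟨c₀, hc₀, hle₀, hmin₀⟩ := exists_isMinOn_intruder hne
  have hex : ∃ n, ∃ c, IsExtremal c ∧ tightCount c = n := ⟨_, c₀, ⟨hc₀, hmin₀⟩, rfl⟩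
  obtain ⟨c, hc, hcn⟩ := Nat.find_spec hex
  refine ⟨c, ⟨hc, fun c' hc' => ?_⟩, ?_⟩
  · rw [hcn]
    exact Nat.find_min' hex ⟨c', hc', rfl⟩
  · rw [hc.intruderDist_eq ⟨hc₀, hmin₀⟩]
    exact hle₀

/-- **GAP(h) fails iff a reduced extremal configuration intrudes below `h`.** -/
theorem not_gapTupleDiam_iff_exists_isReducedExtremal (h : ℝ) :
    ¬ GapTupleDiam h ↔ ∃ c, IsReducedExtremal c ∧ intruderDist c < h := by
  constructor
  · intro hng
    obtain ⟨c₁, hc₁, hlt, hmin⟩ := (not_gapTupleDiam_iff_exists_min h).1 hng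
    obtain ⟨c, hc, -⟩ := exists_isReducedExtremal ⟨c₁, hc₁, hlt.le⟩
    refine ⟨c, hc, ?_⟩
    rw [hc.1.intruderDist_eq ⟨hc₁, hmin⟩]
    exact hlt
  · rintro ⟨c, hc, hlt⟩ hg
    exact absurd ((gapTupleDiam_iff_forall_isGapConfig h).1 hg c hc.1.1) (not_le.2 hlt)

/-! ## P-L1 (no shift), relocation form -/

/-- **No shift at a reduced extremal configuration** (DESIGN-L12-THEORY P-L1 / Musin–Tarasov
2012 Prop. 3.2, relocation form): an admissible configuration `c'` that intrudes no further out
than the reduced extremal `c` has at least as many tight pairs. In particular no relocation of a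
shell ball (or of the intruder direction) that keeps admissibility and the intruder distance can
strictly decrease the number of tight pairs — the geometric "shift" arguments (P-L2: degrees
`0, 3, 4, 5`; corners `< 180°`) all conclude through this lemma. -/
theorem IsReducedExtremal.tightCount_le {c c' : Fin 14 → EuclideanSpace ℝ (Fin 3)}
    (hc : IsReducedExtremal c) (hc' : IsGapConfig c') (hle : intruderDist c' ≤ intruderDist c) :
    tightCount c ≤ tightCount c' :=
  hc.2 c' (hc.1.of_le hc' hle)

/-- Contrapositive, the form used in shift arguments: an admissible configuration with STRICTLY
FEWER tight pairs than a reduced extremal one pushes the intruder strictly further out. -/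
theorem IsReducedExtremal.intruderDist_lt_of_tightCount_lt
    {c c' : Fin 14 → EuclideanSpace ℝ (Fin 3)}
    (hc : IsReducedExtremal c) (hc' : IsGapConfig c') (hlt : tightCount c' < tightCount c) :
    intruderDist c < intruderDist c' := by
  by_contra hle
  exact absurd (hc.tightCount_le hc' (not_lt.1 hle)) (not_le.2 hlt)

/-! ## Completeness may be stated on reduced extremal configurations only -/

namespace GapCensus

variable (S : GapCensus)

/-- **COMPLETENESS on reduced extremal configurations** (the form the theory seats' lemmas
P-L1–P-L3, L actually deliver): every REDUCED EXTREMAL configuration intruding below `h` realises a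
cell of the universe. NAMED HYPOTHESIS. -/
def CompleteReduced (h : ℝ) : Prop :=
  ∀ c, IsReducedExtremal c → intruderDist c < h → ∃ cell ∈ S.univ, S.Realizes cell c

/-- **The glue, reduced form**: a census complete on reduced extremal configurations and fully
killed proves GAP(h). -/
theorem gapTupleDiam_of_completeReduced {h : ℝ} (hC : S.CompleteReduced h) (hK : S.AllKilled) :
    GapTupleDiam h := by
  by_contra hg
  obtain ⟨c, hc, hlt⟩ := (not_gapTupleDiam_iff_exists_isReducedExtremal h).1 hg
  obtain ⟨cell, hcell, hreal⟩ := hC c hc hlt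
  exact hK cell hcell c hc.1.1 hreal

/-- `Complete` (all most-intruding configurations) implies `CompleteReduced`. -/
theorem Complete.completeReduced {S : GapCensus} {h : ℝ} (hC : S.Complete h) :
    S.CompleteReduced h :=
  fun c hc hlt => hC c hc.1.1 hlt hc.1.2

/-- **COMPLETENESS, ∃-form** (the red team's R-16 (b)/(c) shape, cell file
`phase2/red/audit_red_g5_complete.lean`, adopted verbatim): IF some admissible configuration
intrudes below `h` THEN some admissible configuration intruding below `h` realises a cell of the
universe. This is exactly what "take a minimiser with the fewest tight pairs; it has the structure
P-L1–P-L3; hence its tight map is in the generator's class" proves; it is implied by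
`CompleteReduced` (and by `Complete`), and it still composes with `AllKilled`. NAMED HYPOTHESIS. -/
def CompleteExists (h : ℝ) : Prop :=
  (∃ c, IsGapConfig c ∧ intruderDist c < h) →
    ∃ c, IsGapConfig c ∧ intruderDist c < h ∧ ∃ cell ∈ S.univ, S.Realizes cell c

/-- `Complete` implies the ∃-form (red g5). -/
theorem Complete.toExists {S : GapCensus} {h : ℝ} (hC : S.Complete h) : S.CompleteExists h := by
  rintro ⟨c₀, hc₀, hlt⟩
  obtain ⟨c, hc, -, hmin⟩ := exists_isMinOn_intruder ⟨c₀, hc₀, hlt.le⟩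
  have hlt' : intruderDist c < h := (hmin c₀ hc₀).trans_lt hlt
  exact ⟨c, hc, hlt', hC c hc hlt' hmin⟩

/-- `CompleteReduced` implies the ∃-form (through `exists_isReducedExtremal`). -/
theorem CompleteReduced.toExists {S : GapCensus} {h : ℝ} (hC : S.CompleteReduced h) :
    S.CompleteExists h := by
  rintro ⟨c₀, hc₀, hlt⟩
  obtain ⟨c, hc, -⟩ := exists_isReducedExtremal ⟨c₀, hc₀, hlt.le⟩
  have hlt' : intruderDist c < h := (hc.1.2 c₀ hc₀).trans_lt hlt
  exact ⟨c, hc.1.1, hlt', hC c hc hlt'⟩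

/-- **The glue, ∃-form** (red g5): an ∃-complete, fully killed census proves GAP(h). -/
theorem gapTupleDiam_of_censusExists {h : ℝ} (hC : S.CompleteExists h) (hK : S.AllKilled) :
    GapTupleDiam h := by
  rw [gapTupleDiam_iff_forall_isGapConfig]
  intro c hc
  by_contra hlt
  obtain ⟨c', hc', -, cell, hcell, hreal⟩ := hC ⟨c, hc, not_le.1 hlt⟩
  exact hK cell hcell c' hc' hreal

end GapCensus

/-- **End to end, reduced form**: a census complete on reduced extremal configurations, fully
killed, plus the classification at gap `2h`, gives bulk crystallization (`K = 1296`; `702` via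
`Bulk/GapReductionSharp.lean`). -/
theorem bulkCrystallization3D_of_censusReduced_of_classification (S : GapCensus) {h : ℝ}
    (hC : S.CompleteReduced h) (hK : S.AllKilled) (hcl : KissingClassification (2 * h)) :
    BulkCrystallization3D 1296 :=
  bulkCrystallization3D_of_gapTupleDiam_of_classification (S.gapTupleDiam_of_completeReduced hC hK)
    hcl

end Summit.Ventures.Crystal3D

end
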